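import Summits.ResolutionOfSingularities.KangarooAtlas.MizutaniOperatorBasis
import Mathlib.LinearAlgebra.Basis.VectorSpace
import Mathlib.LinearAlgebra.FiniteDimensional.Lemmas
import HarnessLib

/-!
# Two linear-algebra lemmas for Mizutani's Lemma 2.9: the annihilator of a subspace in `End_L(K)`, and triangular families

Cell topic `Summits/ResolutionOfSingularities/KangarooAtlas` (pub-rosobs); namespace
`Summit.ResolutionOfSingularities.KangarooAtlas.Mizutani`.  Mizutani (Nagoya Math. J. 52 (1973), proof of Lemma 2.9, p. 93–94)
counts dimensions through «the exact sequence `0 → Hom_{k^p}(K/T, K) → Hom_{k^p}(K, K) → Hom_{k^p}(T, K) → 0` …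
`dim_K Hom(K/T, K) = p² − n`» and through the linear independence of operators with distinct leading terms.  Here:

* `annihilator L K V` — the `K`-subspace `{Φ ∈ End_L(K) : Φ(V) = 0}`; **`finrank_annihilator_add`** —
  `dim_K annihilator + dim_L V = dim_K End_L(K)` (restriction to `V` is surjective, `Hom_L(V,K)` has `K`-dimension `dim_L V`);
* **`linearIndependent_of_leading`** — a family whose members have DISTINCT leading basis vectors (with respect to an
  injective key `κ`) modulo lower terms is linearly independent.

References: [Mizutani1973HironakaGroupSchemes] Lemma 2.9 (proof, p. 93–94).
-/

noncomputable section

open MvPolynomial Literature.AlgebraicGeometry.Resolution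

namespace Summit.ResolutionOfSingularities.KangarooAtlas.Mizutani

universe u

/-! ### The annihilator of a subspace in `End_L(K)` and its `K`-dimension -/

section Annihilator

variable {L K : Type u} [Field L] [Field K] [Algebra L K]

variable (L K) in
/-- The `K`-subspace of `L`-linear endomorphisms of `K` killing an `L`-subspace `V` (Mizutani: `Hom_{k^p}(K/T, K)` inside
`Hom_{k^p}(K, K)`). [cite: Mizutani1973HironakaGroupSchemes, Lemma 2.9 (proof: the exact sequence 0 → Hom(K/T,K) → Hom(K,K) → Hom(T,K) → 0)] -/
def annihilator (V : Submodule L K) : Submodule K (K →ₗ[L] K) where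
  carrier := {Φ | ∀ y ∈ V, Φ y = 0}
  zero_mem' := fun _ _ => rfl
  add_mem' := fun hΦ hΨ y hy => by rw [LinearMap.add_apply, hΦ y hy, hΨ y hy, add_zero]
  smul_mem' := fun c _ hΦ y hy => by rw [LinearMap.smul_apply, hΦ y hy, smul_zero]

/-- Membership in the annihilator. [folklore] -/
theorem mem_annihilator_iff {V : Submodule L K} {Φ : K →ₗ[L] K} : Φ ∈ annihilator L K V ↔ ∀ y ∈ V, Φ y = 0 :=
  Iff.rfl

variable (L K) in
/-- Restriction to the subspace, a `K`-linear map `End_L(K) → Hom_L(V, K)`. [folklore] -/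
def restrictHom (V : Submodule L K) : (K →ₗ[L] K) →ₗ[K] (V →ₗ[L] K) where
  toFun Φ := Φ ∘ₗ V.subtype
  map_add' _ _ := rfl
  map_smul' _ _ := rfl

/-- **`dim_K {Φ : Φ(V) = 0} + dim_L V = dim_K End_L(K)`** (restriction to `V` is surjective with kernel the annihilator, and
`dim_K Hom_L(V,K) = dim_L V`). [cite: Mizutani1973HironakaGroupSchemes, Lemma 2.9 (proof: dim_K Hom_{k^p}(K/T,K) = p² − n)] -/
theorem finrank_annihilator_add [FiniteDimensional L K] (V : Submodule L K) :
    Module.finrank K (annihilator L K V) + Module.finrank L V = Module.finrank K (K →ₗ[L] K) := by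
  have hker : LinearMap.ker (restrictHom L K V) = annihilator L K V := by
    ext Φ
    simp only [LinearMap.mem_ker, mem_annihilator_iff]
    constructor
    · intro h y hy
      have := congrArg (fun Ψ : V →ₗ[L] K => Ψ ⟨y, hy⟩) h
      simpa [restrictHom] using this
    · intro h
      ext ⟨y, hy⟩
      simpa [restrictHom] using h y hy
  have hrange : LinearMap.range (restrictHom L K V) = ⊤ := by
    rw [LinearMap.range_eq_top]
    intro f
    obtain ⟨g, hg⟩ := LinearMap.exists_extend f
    exact ⟨g, hg⟩
  have h := (restrictHom L K V).finrank_range_add_finrank_ker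
  rw [hrange, finrank_top, hker, Module.finrank_linearMap_self] at h
  omega

end Annihilator

/-! ### Triangular families over a basis are linearly independent -/

section Triangular

variable {K : Type*} [Field K] {E : Type*} [AddCommGroup E] [Module K E] {β : Type*}

/-- **Leading-term criterion**: let `b` be a basis indexed by `β`, `κ : β → ℕ` injective («key»), and `v_l` elements with
`v_l − c_l • b (U l) ∈ span {b W : κ W < κ (U l)}`, `c_l ≠ 0`, `U` injective.  Then the `v_l` are linearly independent
(the relation's term of largest key cannot be cancelled). [folklore] -/
theorem linearIndependent_of_leading {ι : Type*} [Fintype ι] (b : Module.Basis β K E) (κ : β → ℕ)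
    (hκ : Function.Injective κ) (v : ι → E) (U : ι → β) (hU : Function.Injective U) (c : ι → K)
    (hc : ∀ l, c l ≠ 0)
    (hv : ∀ l, v l - c l • b (U l) ∈ Submodule.span K (b '' {W | κ W < κ (U l)})) :
    LinearIndependent K v := by
  classical
  -- the coordinate at `W₀` vanishes on the span of the `b W` with `κ W < κ W₀`-ish keys below `k ≤ κ W₀`
  have hcoord : ∀ (W₀ : β) (k : ℕ), k ≤ κ W₀ → ∀ z ∈ Submodule.span K (b '' {W | κ W < k}), b.repr z W₀ = 0 := by
    intro W₀ k hk z hz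
    induction hz using Submodule.span_induction with
    | mem z hz =>
      obtain ⟨W, hW, rfl⟩ := hz
      have hne : W ≠ W₀ := fun heq => by rw [heq] at hW; exact absurd hW (not_lt.mpr hk)
      rw [b.repr_self, Finsupp.single_eq_of_ne hne.symm]
    | zero => simp
    | add z w _ _ hz hw => rw [map_add, Finsupp.add_apply, hz, hw, add_zero]
    | smul r z _ hz => rw [map_smul, Finsupp.smul_apply, hz, smul_zero]
  rw [Fintype.linearIndependent_iff]
  intro g hg
  by_contra hne
  push Not at hne
  -- the index with nonzero coefficient and largest key
  set Z : Finset ι := Finset.univ.filter fun l => g l ≠ 0 with hZ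
  have hZne : Z.Nonempty := by
    obtain ⟨l, hl⟩ := hne
    exact ⟨l, Finset.mem_filter.mpr ⟨Finset.mem_univ l, hl⟩⟩
  obtain ⟨l₀, hl₀Z, hmax⟩ := Finset.exists_max_image Z (fun l => κ (U l)) hZne
  have hg₀ : g l₀ ≠ 0 := (Finset.mem_filter.mp hl₀Z).2
  -- every other term of the relation lies below the key of `U l₀`
  have hlow : ∀ l, l ≠ l₀ → g l • v l ∈ Submodule.span K (b '' {W | κ W < κ (U l₀)}) := by
    intro l hl
    by_cases hgl : g l = 0
    · rw [hgl, zero_smul]; exact Submodule.zero_mem _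
    have hlt : κ (U l) < κ (U l₀) :=
      lt_of_le_of_ne (hmax l (Finset.mem_filter.mpr ⟨Finset.mem_univ l, hgl⟩))
        (fun heq => hl (hU (hκ heq)))
    refine Submodule.smul_mem _ _ ?_
    have hsplit : v l = (v l - c l • b (U l)) + c l • b (U l) := by abel
    rw [hsplit]
    refine Submodule.add_mem _ (Submodule.span_mono (Set.image_mono fun W (hW : κ W < κ (U l)) =>
      hW.trans hlt) (hv l)) (Submodule.smul_mem _ _ (Submodule.subset_span ⟨U l, hlt, rfl⟩))
  -- isolate the `l₀` term: `g l₀ c l₀ • b (U l₀)` lies below its own key — contradiction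
  have hsum : g l₀ • v l₀ = -∑ l ∈ Finset.univ.erase l₀, g l • v l := by
    rw [← Finset.add_sum_erase _ _ (Finset.mem_univ l₀)] at hg
    exact eq_neg_of_add_eq_zero_left hg
  have hmem : (g l₀ * c l₀) • b (U l₀) ∈ Submodule.span K (b '' {W | κ W < κ (U l₀)}) := by
    have e1 : (g l₀ * c l₀) • b (U l₀) = g l₀ • v l₀ - g l₀ • (v l₀ - c l₀ • b (U l₀)) := by
      rw [smul_sub, mul_smul]; abel
    rw [e1, hsum]
    refine Submodule.sub_mem _ (Submodule.neg_mem _ (Submodule.sum_mem _ fun l hl => hlow l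
      (Finset.ne_of_mem_erase hl))) (Submodule.smul_mem _ _ (hv l₀))
  have h0 := hcoord (U l₀) (κ (U l₀)) le_rfl _ hmem
  rw [map_smul, Finsupp.smul_apply, b.repr_self, Finsupp.single_eq_same, smul_eq_mul, mul_one] at h0
  exact hg₀ ((mul_eq_zero.mp h0).resolve_right (hc l₀))

end Triangular

end Summit.ResolutionOfSingularities.KangarooAtlas.Mizutani

end
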